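import Literature.Analysis.FluidPDE.TorusNSVDataExistenceLimits
import Literature.Analysis.FluidPDE.TorusNSGevreyBootstrap
import Literature.Analysis.FunctionSpaces.TorusGevreyCompactness
import HarnessLib

/-!
# Smooth limit slices of `H¹`-Cauchy families of classical Navier–Stokes solutions on `T^d`

Analysis/FluidPDE proof file (theorems only; no definitions, no named facts): the COMPACTNESS STEP
of the construction of strong solutions from `V`-data by smooth approximation
(Robinson–Rodrigo–Sadowski 2016, Thm 6.8 with Thm 7.5; Foias–Temam 1989 for the Gevrey-class
regularity at positive times). Let `(U_N, P_N)` be classical solutions of NS_ν(F) on `[0, T₀] × T^d`,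
`card d ≤ 3`, `ν > 0`, with mean-zero slices, a common enstrophy bound `‖∇U_N(t)‖₂² ≤ M₁`, a force
with finite Gevrey levels (e.g. a trigonometric polynomial), and a pairwise bound
`∫ ‖U_N(t) − U_M(t)‖² + ‖∇(U_N − U_M)(t)‖₂² ≤ C(ε_N + ε_M)`, `ε_N → 0` (for the solutions issued from
the truncations `P_N v₀` this is `V`-stability, `TorusClassicalNSVStability`). Then
(`Torus.exists_limit_slices_of_h1Cauchy`) there is `u : ℝ → (T^d → ℝ^d)` whose slices on `(0, T₀]`
are smooth, divergence free, mean zero, with `‖∇u(t)‖₂² ≤ M₁`,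
`∫ ‖U_N(t) − u(t)‖² + ‖∇(U_N − u)(t)‖₂² ≤ 2Cε_N`, and uniformly of Gevrey class on every `[τ, T₀]`,
`τ > 0`. Proof: at each `t > 0` the slices `U_N(t)` are uniformly of Gevrey class
(`Torus.IsClassicalNSSolutionOn.gevrey_of_gradNormSq_le` on the window `[t − τ, t]`,
`Torus.exists_gevreyBound_slices`), hence have smooth `H¹`-limits along subsequences
(`Torus.exists_smooth_limit_of_gevrey_bound`), which are limits of the full (Cauchy) sequence with
the rate `2Cε_N` and inherit the enstrophy and Gevrey bounds (`TorusNSVDataExistenceLimits`).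
Deliberately NOT here: that `u` solves the equations (`TorusNSVDataExistenceWindows`).

## Tree search

Reused: `Torus.IsClassicalNSSolutionOn.gevrey_of_gradNormSq_le` (`TorusNSGevreyBootstrap`),
`Torus.exists_smooth_limit_of_gevrey_bound` (`TorusGevreyCompactness`),
`Torus.h1DistSq_le_of_tendsto`, `Torus.gradNormSq_le_of_tendsto`,
`Torus.eq_of_tendsto_integral_norm_sub_sq` (`TorusNSVDataExistenceLimits`).

## References

* J. C. Robinson, J. L. Rodrigo, W. Sadowski, *The Three-Dimensional Navier–Stokes Equations*,
  CUP 2016, Thm 6.8, Thm 7.5. [RobinsonRodrigoSadowskiCUP2016]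
* C. Foias, R. Temam, *Gevrey class regularity for the solutions of the Navier–Stokes equations*,
  JFA 87 (1989), Thm 1.1. [FoiasTemam1989]
-/

noncomputable section

open MeasureTheory Set Function Filter UnitAddTorus
open scoped ContDiff InnerProductSpace Topology ENNReal

namespace Literature.Analysis.FluidPDE

open Literature.Analysis.FunctionSpaces

variable {d : Type*} [Fintype d] [DecidableEq d] [Nonempty d]

/-- **Uniform Gevrey bound of the slices of classical solutions away from the initial time**
(Foias–Temam 1989, Thm 1.1, read on the windows `[t − τ, t]`): on `T^d`, `card d ≤ 3`, for `ν > 0`,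
a window length `τ > 0`, a Gevrey level `G` of the force at `τ` and an enstrophy level `M₁` there
are `σ > 0` and `C` such that every classical solution of NS_ν(F) on `[0, T₀] × T^d` with mean-zero
slices and `‖∇u(t)‖₂² ≤ M₁` satisfies `∑_{k∈S} e^{2σ|k|}‖𝓕(u t)(k)‖² ≤ C` for all `t ∈ [τ, T₀]` and
all finite `S`. [cite: FoiasTemam1989, Thm 1.1] -/
theorem Torus.exists_gevreyBound_slices (hd : Fintype.card d ≤ 3) {ν : ℝ} (hν : 0 < ν)
    {F : UnitAddTorus d → EuclideanSpace ℝ d} {τ G : ℝ} (hτ : 0 < τ)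
    (hG : ∀ R : ℕ, ∑ k ∈ Torus.freqBall R, Real.exp (τ * Real.sqrt (Torus.freqNormSq k)) ^ 2 *
      (Torus.freqNormSq k * ‖mFourierCoeff (EuclideanSpace.complexify ∘ F) k‖ ^ 2) ≤ G) (M₁ : ℝ) :
    ∃ σ : ℝ, 0 < σ ∧ ∃ Cσ : ℝ, ∀ {T₀ : ℝ} {u : ℝ → UnitAddTorus d → EuclideanSpace ℝ d}
      {p : ℝ → UnitAddTorus d → ℝ}, Torus.IsClassicalNSSolutionOn (Icc 0 T₀) ν (fun _ => F) u p →
      (∀ t ∈ Icc 0 T₀, Torus.HasZeroMean (u t)) → (∀ t ∈ Icc 0 T₀, Torus.gradNormSq (u t) ≤ M₁) →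
      ∀ t ∈ Icc τ T₀, ∀ S : Finset (d → ℤ),
        ∑ k ∈ S, Real.exp (2 * σ * Real.sqrt (Torus.freqNormSq k)) *
          ‖mFourierCoeff (EuclideanSpace.complexify ∘ u t) k‖ ^ 2 ≤ Cσ := by
  obtain ⟨σ, hσ, Cσ, hC⟩ :=
    Torus.IsClassicalNSSolutionOn.gevrey_of_gradNormSq_le (d := d) hd hν M₁ τ G hτ
  refine ⟨σ, hσ, Cσ, fun {T₀ u p} h hmean hM t ht S => ?_⟩
  have hsub : Icc (t - τ) (t - τ + τ) ⊆ Icc 0 T₀ := by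
    rw [sub_add_cancel]
    exact Icc_subset_Icc (by linarith [ht.1]) ht.2
  have hlt : t - τ < t - τ + τ := by linarith
  have hres := hC (h.mono hsub (uniqueDiffOn_Icc hlt)) (fun s hs => hmean s (hsub hs))
    (fun s hs => hM s (hsub hs)) (fun s _ R => hG R) S
  rwa [sub_add_cancel] at hres

/-- **Smooth limit slices of an `H¹`-Cauchy family of classical Navier–Stokes solutions**
(Robinson–Rodrigo–Sadowski 2016, proof of Thm 6.8 with Thm 7.5: the solutions issued from the
truncations `P_N u₀` converge, and the limit is smooth for `t > 0`). On `T^d`, `card d ≤ 3`, let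
`(U_N, P_N)` solve NS_ν(F), `ν > 0`, classically on `[0, T₀] × T^d` with mean-zero slices,
`‖∇U_N(t)‖₂² ≤ M₁`, a force `F` with finite Gevrey levels, and
`∫ ‖U_N(t) − U_M(t)‖² + ‖∇(U_N − U_M)(t)‖₂² ≤ C(ε_N + ε_M)` on `[0, T₀]` with `ε_N → 0`. Then there
is `u` with: for `t ∈ (0, T₀]` the slice `u(t)` is smooth, divergence free, mean zero, with
`‖∇u(t)‖₂² ≤ M₁` and `∫ ‖U_N(t) − u(t)‖² + ‖∇(U_N − u)(t)‖₂² ≤ 2Cε_N` for all `N`; and for every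
`τ > 0` there are `σ > 0`, `C_g` with `∑_{k∈S} e^{2σ|k|}‖𝓕(u t)(k)‖² ≤ C_g` for `t ∈ [τ, T₀]` and
all finite `S`. [cite: RobinsonRodrigoSadowskiCUP2016, Thm 6.8 with Thm 7.5] -/
theorem Torus.exists_limit_slices_of_h1Cauchy (hd : Fintype.card d ≤ 3) {ν : ℝ} (hν : 0 < ν)
    {F : UnitAddTorus d → EuclideanSpace ℝ d}
    (hF : ∀ τ : ℝ, ∃ G : ℝ, ∀ R : ℕ, ∑ k ∈ Torus.freqBall R,
      Real.exp (τ * Real.sqrt (Torus.freqNormSq k)) ^ 2 *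
        (Torus.freqNormSq k * ‖mFourierCoeff (EuclideanSpace.complexify ∘ F) k‖ ^ 2) ≤ G)
    {T₀ M₁ C : ℝ} {U : ℕ → ℝ → UnitAddTorus d → EuclideanSpace ℝ d} {P : ℕ → ℝ → UnitAddTorus d → ℝ}
    (hU : ∀ N, Torus.IsClassicalNSSolutionOn (Icc 0 T₀) ν (fun _ => F) (U N) (P N))
    (hUmean : ∀ N, ∀ t ∈ Icc 0 T₀, Torus.HasZeroMean (U N t))
    (hUM : ∀ N, ∀ t ∈ Icc 0 T₀, Torus.gradNormSq (U N t) ≤ M₁) {ε : ℕ → ℝ}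
    (hε : Tendsto ε atTop (𝓝 0))
    (hpair : ∀ N M, ∀ t ∈ Icc 0 T₀, (∫ x, ‖U N t x - U M t x‖ ^ 2) +
      Torus.gradNormSq (fun x => U N t x - U M t x) ≤ C * (ε N + ε M)) :
    ∃ u : ℝ → UnitAddTorus d → EuclideanSpace ℝ d,
      (∀ t ∈ Ioc 0 T₀, Torus.IsSmooth (u t) ∧ Torus.IsDivFree (u t) ∧ Torus.HasZeroMean (u t) ∧
        Torus.gradNormSq (u t) ≤ M₁) ∧
      (∀ t ∈ Ioc 0 T₀, ∀ N, (∫ x, ‖U N t x - u t x‖ ^ 2) +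
        Torus.gradNormSq (fun x => U N t x - u t x) ≤ 2 * C * ε N) ∧
      (∀ τ : ℝ, 0 < τ → ∃ σ : ℝ, 0 < σ ∧ ∃ Cg : ℝ, ∀ t ∈ Icc τ T₀, ∀ S : Finset (d → ℤ),
        ∑ k ∈ S, Real.exp (2 * σ * Real.sqrt (Torus.freqNormSq k)) *
          ‖mFourierCoeff (EuclideanSpace.complexify ∘ u t) k‖ ^ 2 ≤ Cg) := by
  -- smoothness of the slices of the approximants
  have hUs : ∀ N, ∀ t ∈ Icc 0 T₀, Torus.IsSmooth (U N t) := fun N t ht =>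
    (hU N).smooth_velocity.isSmooth_slice ht
  -- Step 1: the limit slice at each `t ∈ (0, T₀]`, with the rate of the full sequence
  have key : ∀ t ∈ Ioc 0 T₀, ∃ w : UnitAddTorus d → EuclideanSpace ℝ d, Torus.IsSmooth w ∧
      Torus.IsDivFree w ∧ Torus.HasZeroMean w ∧
      ∀ N, (∫ x, ‖U N t x - w x‖ ^ 2) + Torus.gradNormSq (fun x => U N t x - w x) ≤ 2 * C * ε N := by
    intro t ht
    have htI : t ∈ Icc 0 T₀ := ⟨ht.1.le, ht.2⟩
    obtain ⟨G, hG⟩ := hF t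
    obtain ⟨σ, hσ, Cσ, hCσ⟩ := Torus.exists_gevreyBound_slices hd hν ht.1 hG M₁
    have hGev : ∀ N, ∀ S : Finset (d → ℤ),
        ∑ k ∈ S, Real.exp (2 * σ * Real.sqrt (Torus.freqNormSq k)) *
          ‖mFourierCoeff (EuclideanSpace.complexify ∘ U N t) k‖ ^ 2 ≤ Cσ := fun N =>
      hCσ (hU N) (hUmean N) (hUM N) t ⟨le_rfl, ht.2⟩
    obtain ⟨w, ψ, hψ, hw, hwdiv, hwmean, -, hL2, hH1⟩ :=
      Torus.exists_smooth_limit_of_gevrey_bound hσ (fun N => U N t) (fun N => hUs N t htI)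
        (fun N => (hU N).divFree t htI) (fun N => hUmean N t htI) hGev
    refine ⟨w, hw, hwdiv, hwmean, fun N => ?_⟩
    have hδ : Tendsto (fun m => C * ε (ψ m)) atTop (𝓝 0) := by
      simpa using (hε.comp hψ.tendsto_atTop).const_mul C
    have h := Torus.h1DistSq_le_of_tendsto (hUs N t htI) (fun m => hUs (ψ m) t htI) hw
      (B := C * ε N) (δ := fun m => C * ε (ψ m)) (c := fun m => U (ψ m) t)
      (fun m => by have h1 := hpair N (ψ m) t htI; linarith) hδ hL2 hH1
    linarith
  choose! w hws hwdiv hwmean hrate using key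
  -- convergence of the full sequence, in `L²` and in `Ḣ¹`
  have hconv : ∀ t ∈ Ioc 0 T₀, Tendsto (fun N => ∫ x, ‖U N t x - w t x‖ ^ 2) atTop (𝓝 0) ∧
      Tendsto (fun N => Torus.gradNormSq (fun x => U N t x - w t x)) atTop (𝓝 0) := by
    intro t ht
    have hlim : Tendsto (fun N => 2 * C * ε N) atTop (𝓝 0) := by simpa using hε.const_mul (2 * C)
    have h0 : ∀ N, 0 ≤ ∫ x, ‖U N t x - w t x‖ ^ 2 := fun N => integral_nonneg fun x => sq_nonneg _
    have h0' : ∀ N, 0 ≤ Torus.gradNormSq (fun x => U N t x - w t x) := fun N =>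
      Torus.gradNormSq_nonneg _
    refine ⟨tendsto_of_tendsto_of_tendsto_of_le_of_le tendsto_const_nhds hlim h0 fun N => ?_,
      tendsto_of_tendsto_of_tendsto_of_le_of_le tendsto_const_nhds hlim h0' fun N => ?_⟩
    · linarith [hrate t ht N, h0' N]
    · linarith [hrate t ht N, h0 N]
  refine ⟨w, fun t ht => ⟨hws t ht, hwdiv t ht, hwmean t ht, ?_⟩, hrate, fun τ hτ => ?_⟩
  · -- the enstrophy bound passes to the limit
    have htI : t ∈ Icc 0 T₀ := ⟨ht.1.le, ht.2⟩
    exact Torus.gradNormSq_le_of_tendsto (fun m => hUs m t htI) (hws t ht) (fun m => hUM m t htI)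
      (hconv t ht).2
  · -- uniform Gevrey bound on `[τ, T₀]`: the limit along a subsequence is the limit
    obtain ⟨G, hG⟩ := hF τ
    obtain ⟨σ, hσ, Cσ, hCσ⟩ := Torus.exists_gevreyBound_slices hd hν hτ hG M₁
    refine ⟨σ, hσ, Cσ, fun t ht S => ?_⟩
    have ht' : t ∈ Ioc 0 T₀ := ⟨hτ.trans_le ht.1, ht.2⟩
    have htI : t ∈ Icc 0 T₀ := ⟨ht'.1.le, ht.2⟩
    have hGev : ∀ N, ∀ S : Finset (d → ℤ),
        ∑ k ∈ S, Real.exp (2 * σ * Real.sqrt (Torus.freqNormSq k)) *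
          ‖mFourierCoeff (EuclideanSpace.complexify ∘ U N t) k‖ ^ 2 ≤ Cσ := fun N =>
      hCσ (hU N) (hUmean N) (hUM N) t ht
    obtain ⟨w', ψ, hψ, hw', -, -, hw'G, hL2, -⟩ :=
      Torus.exists_smooth_limit_of_gevrey_bound hσ (fun N => U N t) (fun N => hUs N t htI)
        (fun N => (hU N).divFree t htI) (fun N => hUmean N t htI) hGev
    have heq : w t = w' :=
      Torus.eq_of_tendsto_integral_norm_sub_sq (v := fun m => U (ψ m) t) (fun m => hUs (ψ m) t htI)
        (hws t ht') hw' ((hconv t ht').1.comp hψ.tendsto_atTop) hL2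
    rw [heq]
    exact hw'G S

end Literature.Analysis.FluidPDE

end
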